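import Mathlib
import Summits.PneNP.PneNP.Theses.OneSlice
import Summits.PneNP.PneNP.Theorems.OneSliceSliceTargetSplit
import Summits.PneNP.PneNP.Theorems.OneSliceMonotoneContinuationTowerUp
import Summits.PneNP.PneNP.Theorems.OneSliceMonotoneContinuationLevelAverage

/-!
# Route OneSlice, crux `MonotoneContinuation` (stmt-PneNP-18471), line `Sketch_ideator1_r1` (ProfileLine) — stub nearBoolean_mono_below

NEAR-BOOLEANNESS OF THE TRANSPORT PROPAGATES TOWARD THE SLICE FROM BELOW (deletion side; the mirror image of
`nearBoolean_mono_above`). Write `ĝ = T_j 𝟙[f]` (`transport j (ind f)`) for the slice-`j` transport of the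
indicator of `f`. For `s ≤ r ≤ j ≤ N = C(n,2)` the level-uniform mean of `ĝ(1 - ĝ) = ĝ - ĝ²` on the Hamming
slice `r` is at most the one on the lower slice `s`.
Proof (tower + Jensen): the level means of `ĝ` on the slices `r` and `s` coincide — both equal the slice-`j`
mean of `𝟙[f]` (`stub_levelAverage`) — so it suffices that the level mean of `ĝ²` does not increase from `r`
down to `s`. By the upward tower property (`transport_tower_up`) `ĝ(y)` is, for `y ∈ slice s` (so
`e(y) = s ≤ r ≤ j`), the average of `ĝ` over the `r`-supersets `nbhd r y` of `y`, i.e. `ĝ(y) = T_r ĝ (y)`,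
whence `ĝ(y)² ≤ T_r(ĝ²)(y)` (Cauchy–Schwarz, `sq_sum_le_card_mul_sum_sq`); summing over `slice s` and using
the flat level averages of the slice-`r` transport (`stub_levelAverage` again, now for `ĝ²`) gives
`Σ_{slice s} ĝ² ≤ #slice_s · (Σ_{slice r} ĝ²)/#slice_r`.
-/

set_option linter.dupNamespace false -- `Summit.PneNP.PneNP.…`: summit = sub-problem (D-0017)

namespace Summit.PneNP.PneNP.Theorems.MonotoneContinuation

open Literature.Computability.Complexity hiding supp mem_supp
open Finset hiding slice
open Filter hiding mem_sdiff
open Classical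
open Summit.PneNP.PneNP.Theorems (binomialWeight_tail_le binomialWeight_sum_range binomialWeight_nonneg
  binomialWeight_variance card_slice)
open Summit.PneNP.PneNP.Theorems.ConstantBand.Negative (Edge thr Central slice)
open Summit.PneNP.PneNP.Theorems.SingleThreshold.Negative (pc)
open Summit.PneNP.PneNP.Theorems.SliceACZero.Negative (supp mem_supp card_supp supp_injective supp_indicator)
open Summit.PneNP.PneNP.Theorems.SliceTargetSplit (Comp nbhd mem_nbhd transport ind l1 nbhdCard card_nbhd
  card_nbhd_of_le card_nbhd_of_ge choose_mul_nbhdCard nbhdCard_pos sum_slice_sum_nbhd sum_slice_sum_nbhd_left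
  supp_subset_of_comp_of_le comp_iff_supp comp_comm ofSet supp_ofSet ofSet_supp edgeCount_ofSet ind_nonneg
  ind_le_one abs_ind_sub_ind l1_triangle l1_comm l1_nonneg transport_nonneg transport_sub)

noncomputable section

variable {n : ℕ}

/-- **Jensen for the transport**: the square of the slice-`r` transport of `g` at `y` is at most the slice-`r`
transport of `g²` at `y` — Cauchy–Schwarz (`sq_sum_le_card_mul_sum_sq`) for the uniform average over
`nbhd r y` (both sides vanish on an empty neighbourhood). [folklore] -/
theorem nearBooleanBelow_transport_sq_le (r : ℕ) (g : (Edge n → Bool) → ℝ) (y : Edge n → Bool) :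
    transport r g y ^ 2 ≤ transport r (fun u => g u ^ 2) y := by
  unfold transport
  rcases (nbhd r y).eq_empty_or_nonempty with h | h
  · simp [h]
  have hS : (0 : ℝ) < #(nbhd r y) := by exact_mod_cast h.card_pos
  rw [div_pow, div_le_div_iff₀ (pow_pos hS 2) hS]
  calc (∑ x ∈ nbhd r y, g x) ^ 2 * #(nbhd r y) ≤ (#(nbhd r y) * ∑ x ∈ nbhd r y, g x ^ 2) * #(nbhd r y) :=
        mul_le_mul_of_nonneg_right sq_sum_le_card_mul_sum_sq hS.le
    _ = (∑ x ∈ nbhd r y, g x ^ 2) * (#(nbhd r y) : ℝ) ^ 2 := by ring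

/-- **Jensen through the upward tower**: for `e(y) ≤ r ≤ j ≤ C(n,2)` the square of the slice-`j` transport at
`y` is at most the slice-`r` transport at `y` of the square of the slice-`j` transport (`T_j g y` is the average
of `T_j g` over the `r`-supersets `nbhd r y`, `transport_tower_up`, i.e. `T_j g y = T_r (T_j g) y`). [folklore] -/
theorem nearBooleanBelow_sq_transport_le {j r : ℕ} (g : (Edge n → Bool) → ℝ) {y : Edge n → Bool}
    (hyr : edgeCount y ≤ r) (hrj : r ≤ j) (hj : j ≤ n.choose 2) :
    transport j g y ^ 2 ≤ transport r (fun u => transport j g u ^ 2) y := by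
  have h : transport j g y = transport r (transport j g) y := transport_tower_up n j r g y hyr hrj hj
  rw [h]
  exact nearBooleanBelow_transport_sq_le r _ y

/-- **Level means of the squared transport do not increase downward**: for `s ≤ r ≤ j ≤ C(n,2)` the
level-uniform mean of `(T_j g)²` on the slice `s` is at most the one on the slice `r` (pointwise Jensen through
the upward tower, summed over `slice s`, plus the flat level averages of the slice-`r` transport,
`stub_levelAverage`). [folklore] -/
theorem nearBooleanBelow_sum_sq_div_le {j r s : ℕ} (g : (Edge n → Bool) → ℝ) (hsr : s ≤ r) (hrj : r ≤ j)
    (hj : j ≤ n.choose 2) :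
    (∑ y ∈ slice n s, transport j g y ^ 2) / #(slice n s) ≤
      (∑ u ∈ slice n r, transport j g u ^ 2) / #(slice n r) := by
  have hs : s ≤ n.choose 2 := hsr.trans (hrj.trans hj)
  have hpos : (0 : ℝ) < #(slice n s) := by rw [card_slice]; exact_mod_cast Nat.choose_pos hs
  rw [div_le_iff₀ hpos]
  calc ∑ y ∈ slice n s, transport j g y ^ 2
      ≤ ∑ y ∈ slice n s, transport r (fun u => transport j g u ^ 2) y :=
        sum_le_sum fun y hy =>
          nearBooleanBelow_sq_transport_le g (by rw [(mem_filter.1 hy).2]; exact hsr) hrj hj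
    _ = (#(slice n s) : ℝ) * ((∑ u ∈ slice n r, transport j g u ^ 2) / #(slice n r)) :=
        stub_levelAverage n s r _ hs (hrj.trans hj)
    _ = (∑ u ∈ slice n r, transport j g u ^ 2) / #(slice n r) * #(slice n s) := mul_comm _ _

/-- **Near-Booleanness propagates toward the slice from below** (sub-goal `nearBoolean_mono_below` of the line
`Sketch_ideator1_r1`, deletion side; tower + Jensen): for `s ≤ r ≤ j ≤ C(n,2)` the level-uniform mean of
`ĝ(1 − ĝ)`, `ĝ = T_j 𝟙[f]`, is smaller on level `r` than on the lower level `s` — the level means of `ĝ` agree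
(`stub_levelAverage`) while the level mean of `ĝ²` does not increase from `r` down to `s`
(`nearBooleanBelow_sum_sq_div_le`). [folklore] -/
theorem nearBoolean_mono_below :
  ∀ (n j r s : ℕ) (f : (Edge n → Bool) → Bool), s ≤ r → r ≤ j → j ≤ n.choose 2 →
    (∑ u ∈ slice n r, transport j (ind f) u * (1 - transport j (ind f) u)) / #(slice n r) ≤
      (∑ y ∈ slice n s, transport j (ind f) y * (1 - transport j (ind f) y)) / #(slice n s) := by
  intro n j r s f hsr hrj hj
  have hr : r ≤ n.choose 2 := hrj.trans hj
  have hs : s ≤ n.choose 2 := hsr.trans hr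
  have hr0 : (0 : ℝ) < #(slice n r) := by rw [card_slice]; exact_mod_cast Nat.choose_pos hr
  have hs0 : (0 : ℝ) < #(slice n s) := by rw [card_slice]; exact_mod_cast Nat.choose_pos hs
  have key := nearBooleanBelow_sum_sq_div_le (ind f) hsr hrj hj
  -- split the level sums of `ĝ(1 - ĝ)` into the level sums of `ĝ` minus those of `ĝ²`
  have hsplit : ∀ t : Finset (Edge n → Bool),
      ∑ u ∈ t, transport j (ind f) u * (1 - transport j (ind f) u) =
        ∑ u ∈ t, transport j (ind f) u - ∑ u ∈ t, transport j (ind f) u ^ 2 := fun t => by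
    rw [← sum_sub_distrib]
    exact sum_congr rfl fun u _ => by ring
  rw [hsplit, hsplit, stub_levelAverage n r j (ind f) hr hj, stub_levelAverage n s j (ind f) hs hj, sub_div,
    sub_div, mul_div_cancel_left₀ _ hr0.ne', mul_div_cancel_left₀ _ hs0.ne']
  exact sub_le_sub_left key _

end

end Summit.PneNP.PneNP.Theorems.MonotoneContinuation
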